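import Summits.CriticalPhenomena.PercolationContinuityZ3.Theorems.PercNearOneGluingNoHeavyLowerTailCubicThreePointTerminalClosure
import Mathlib.Analysis.Calculus.Deriv.Mul
import Mathlib.Analysis.Calculus.Deriv.Add
import Mathlib.Tactic.Ring
import Mathlib.Tactic.Linarith
import Mathlib.Tactic.Positivity
import HarnessLib

/-!
# `NoHeavyLowerTail` (stmt-CriticalPhenomena-4575) — FIRST-ORDER STABILITY of the two tight loci of the sharp cubic row
# `SF3-Hmax = max(Ha, Hb) ≥ 0`: at every blob network and every hub network the first-order effect of a new coupling is
# nonnegative, and is controlled EXACTLY by Gladkov's `AG` of the two sub-networks that the coupling touches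

Support file (prover prim-gen-kcluster gen 28; `--supports stmt-CriticalPhenomena-4575`; memo
run/shared/lean/prim/prim-gen-kcluster/KCLUSTER-gen28.md §5).  Pure algebra over a commutative ring / `ℝ` plus one-variable
calculus (`HasDerivAt`); no measure theory, no named facts, no sorries, no new definitions.  Cell convention of
`…CubicThreePointTerminalClosure`: a three-point law is `(q, u₁, u₂, u₃, t) = (P(a|b|c), P(ab|c), P(ac|b), P(bc|a), P(abc))`,
`AG = q t − e₂(u)` (Gladkov's three-point strong Harris–Kleitman form, `≥ 0` on every bond-percolation law: tree theorem
`Literature.Probability.Percolation.prodBernoulli_threePoint_strongHarris`), `Ha = t·AG − e₃(u)`, `Hb = q·AG − e₃(u)`.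

CONTEXT.  The conjecture of record SF3-Hmax (KCLUSTER-FINAL §3 C1: `max(Ha, Hb) ≥ 0` for every 3-terminal bond-percolation law)
is TIGHT on two families: `Hb ≡ 0` on BLOB networks (a triangle `a b c` whose sides are arbitrary independent two-terminal
networks `N_ab, N_bc, N_ca`; law = the triangle law with side probabilities `α = P(a~b in N_ab)`, `β`, `z`; `Hb_triangle` of
`…CubicThreePointSharpDichotomy`) and `Ha ≡ 0` on HUB networks (three independent arms `N_a, N_b, N_c` from the terminals to a
hub `h`; law = the star law with arm probabilities `α, β, γ`; `Ha_star`).  Every census of the lineage finds the conjecture hardest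
exactly next to these loci (KCLUSTER-gen28 §2: large 'fuzzy hubs' reach `e₃/(max(q,t)AG) = 0.99` with `Hb = +O(10⁻⁵)`).  This file
proves that the loci are FIRST-ORDER STABLE under the generic 'prime' perturbation — coupling an internal vertex `v` of one
sub-network to an internal vertex `w` of another by a new edge of weight `y` — and that the first-order coefficient is an explicit
nonnegative combination of the Aas–Gladkov forms of the two sub-networks touched:

THEOREM B (blob locus; `hasDerivAt_Hb_blob`, `blob_firstOrder_nonneg`).  Let `(T₁,A₁,B₁,V₁,Q₁)` be the three-point law of
`(a, b, v)` inside `N_ab` (`T₁` all joined, `A₁` = `a` apart & `b~v`, `B₁` = `b` apart & `a~v`, `V₁` = `v` apart & `a~b`, `Q₁` all apart;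
`α = T₁+V₁ = P(a~b)`), `(T₂,B₂,C₂,W₂,Q₂)` that of `(b, c, w)` inside `N_bc` (`B₂` = `b` apart & `c~w`, `C₂` = `c` apart & `b~w`, `W₂` = `w`
apart & `b~c`; `β = T₂+W₂`), `z = P(c~a in N_ca)`.  Adding the edge `vw` with weight `y` gives the law `L₀ + y·δ` EXACTLY
(`law(B + y·vw) = (1−y)·law(B) + y·law(B/{v=w})`), with the blob law `L₀ = ((1−α)(1−β)(1−z), α(1−β)(1−z), (1−α)(1−β)z, (1−α)β(1−z),
αβ + (α(1−β)+(1−α)β)z)` and the direction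
`δ = (−(1−z)(A₁B₂+B₁B₂+B₁C₂), (1−z)(B₁C₂−T₁B₂), (1−z)B₁B₂ − z(A₁B₂+B₁C₂), (1−z)(A₁B₂−B₁T₂), (1−z)(T₁B₂+B₁T₂) + z(A₁B₂+B₁C₂))`
(case table: `T₁×B₂` moves `u₁ → t` when `ca` is closed; `A₁×B₂` moves `u₂ → t` (`ca` open) / `q → u₃` (`ca` closed); `B₁×T₂`: `u₃ → t` (`ca`
closed); `B₁×B₂`: `q → u₂` (`ca` closed); `B₁×C₂`: `u₂ → t` (`ca` open) / `q → u₁` (`ca` closed); all other cell pairs: no change).  Then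
   `d/dy|_{y=0} Hb(L₀ + yδ) = (1−α)(1−β)(1−z)² · [ B₂·(AG₁ + A₁B₁) + B₁·(AG₂ + B₂C₂) ]  ≥ 0`,
`AG₁ = Q₁T₁ − (A₁B₁+A₁V₁+B₁V₁)`, `AG₂ = Q₂T₂ − (B₂C₂+B₂W₂+C₂W₂)`.  Since `Hb(L₀) = 0` (`Hb_blob_eq_zero`), `Hb(law(B + y·vw)) = D·y + O(y²)`
with `D ≥ 0`: the sharp row's `q`-sheet cannot be crossed to first order at any blob network by any single new edge (edges inside one
side keep the law on the locus; an endpoint at a terminal is the degenerate case `v = a` etc. of the same formula).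

THEOREM H (hub locus; `hasDerivAt_Ha_hub`, `hub_firstOrder_nonneg`).  With `(T₁,A₁,H₁,V₁,Q₁)` the law of `(a, h, v)` in the arm
`N_a` (`H₁` = `h` apart & `a~v`; `α = T₁+V₁ = P(a~h)`), `(T₂,B₂,H₂,W₂,Q₂)` that of `(b, h, w)` in `N_b` (`β = T₂+W₂`), `γ = P(c~h)`, the
star law `L₀ = (1−αβ−αγ−βγ+2αβγ, αβ(1−γ), α(1−β)γ, (1−α)βγ, αβγ)` and the chord direction
`δ = (−(1−γ)(T₁H₂+H₁T₂+H₁H₂) − γ(A₁H₂+H₁B₂+H₁H₂), (1−γ)(T₁H₂+H₁T₂) + H₁H₂, γ(H₁B₂−T₁H₂), γ(A₁H₂−H₁T₂), γ(T₁H₂+H₁T₂))`: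
   `d/dy|_{y=0} Ha(L₀ + yδ) = αβγ² · [ H₂·AG₁ + H₁·AG₂ + H₁H₂·(α + β + A₁ + B₂ − 1) ]`,
which is `≥ 0` as soon as `α + β ≥ 1` — in particular throughout the DENSE regime `t₀ ≥ q₀` of the star law, where `Ha` is the
binding sheet (`dense_star_arm_sum`: `t₀ ≥ q₀ ⟹ α + β ≥ 1`).  (In the sparse regime the bracket can be negative, harmlessly:
there `Hb ≥ Ha + (q−t)·AG` has slack.)

So: Gladkov's QUADRATIC inequality inside the two sub-networks is exactly what makes the CUBIC row first-order stable at its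
tight loci; Harris alone is not enough (exact pseudo-law counterexamples with all three 2×2 Harris determinants of both channel laws
nonnegative: KCLUSTER-gen28 §5, 9,298 of 59,854 samples).  The identities were found by computer algebra on the 25-cell gluing
table and are checked here by `ring`; the graph-level dictionary (the 25-cell table itself, i.e. that `law(B/{v=w}) = L₀ + δ`) is the
standard terminal-gluing computation and is recorded in the docstrings, not formalised in this file.
[cite: Gladkov2024StrongFKG, Cor. 4.2 (the quadratic form AG)]; [cite: GrimmettManolescuAOP2013, star–triangle transformation (the two loci are Y–Δ dual)]
-/

namespace Summit.CriticalPhenomena.PercolationContinuityZ3.Theorems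

namespace CubicThreePointLocus

open CubicThreePointTerminal

section Identities

variable {R : Type*} [CommRing R]

/-- **Blob locus, gradient identity** (any commutative ring; `σ₁ = σ₂ = 1` imposed by eliminating `Q₁, Q₂`): the directional derivative
`∇Hb(L₀)·δ` — written out with `∂Hb/∂q = 2qt − e₂`, `∂Hb/∂u₁ = −q(u₂+u₃) − u₂u₃` (cyclically), `∂Hb/∂t = q²` at the blob law — equals
`(1−α)(1−β)(1−z)²·[B₂(T₁Q₁ − V₁(A₁+B₁)) + B₁(T₂Q₂ − W₂(B₂+C₂))]` with `Q₁ = 1−T₁−A₁−B₁−V₁`, `Q₂ = 1−T₂−B₂−C₂−W₂`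
(note `T₁Q₁ − V₁(A₁+B₁) = AG₁ + A₁B₁`). [this work] -/
theorem blob_gradient_identity (T₁ A₁ B₁ V₁ T₂ B₂ C₂ W₂ z : R) :
    let α := T₁ + V₁
    let β := T₂ + W₂
    let q₀ := (1 - α) * (1 - β) * (1 - z)
    let u₁₀ := α * (1 - β) * (1 - z)
    let u₂₀ := (1 - α) * (1 - β) * z
    let u₃₀ := (1 - α) * β * (1 - z)
    let t₀ := α * β + (α * (1 - β) + (1 - α) * β) * z
    let δq := -((1 - z) * (A₁ * B₂ + B₁ * B₂ + B₁ * C₂))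
    let δu₁ := (1 - z) * (B₁ * C₂ - T₁ * B₂)
    let δu₂ := (1 - z) * (B₁ * B₂) - z * (A₁ * B₂ + B₁ * C₂)
    let δu₃ := (1 - z) * (A₁ * B₂ - B₁ * T₂)
    let δt := (1 - z) * (T₁ * B₂ + B₁ * T₂) + z * (A₁ * B₂ + B₁ * C₂)
    (2 * q₀ * t₀ - (u₁₀ * u₂₀ + u₁₀ * u₃₀ + u₂₀ * u₃₀)) * δq
      + (-(q₀ * (u₂₀ + u₃₀)) - u₂₀ * u₃₀) * δu₁ + (-(q₀ * (u₁₀ + u₃₀)) - u₁₀ * u₃₀) * δu₂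
      + (-(q₀ * (u₁₀ + u₂₀)) - u₁₀ * u₂₀) * δu₃ + q₀ ^ 2 * δt
    = (1 - α) * (1 - β) * (1 - z) ^ 2 *
        (B₂ * (T₁ * (1 - T₁ - A₁ - B₁ - V₁) - V₁ * (A₁ + B₁))
          + B₁ * (T₂ * (1 - T₂ - B₂ - C₂ - W₂) - W₂ * (B₂ + C₂))) := by
  intro α β q₀ u₁₀ u₂₀ u₃₀ t₀ δq δu₁ δu₂ δu₃ δt
  simp only [α, β, q₀, u₁₀, u₂₀, u₃₀, t₀, δq, δu₁, δu₂, δu₃, δt]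
  ring

/-- **Hub locus, gradient identity** (any commutative ring; `Q`'s eliminated): `∇Ha(L₀)·δ` at the star law — `∂Ha/∂q = t²`,
`∂Ha/∂u₁ = −t(u₂+u₃) − u₂u₃` (cyclically), `∂Ha/∂t = 2qt − e₂` — equals `αβγ²·[H₂·AG₁ + H₁·AG₂ + H₁H₂(α+β+A₁+B₂−1)]` with
`AG₁ = T₁Q₁ − (A₁H₁+A₁V₁+H₁V₁)`, `Q₁ = 1−T₁−A₁−H₁−V₁`, and similarly `AG₂`. [this work] -/
theorem hub_gradient_identity (T₁ A₁ H₁ V₁ T₂ B₂ H₂ W₂ γ : R) :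
    let α := T₁ + V₁
    let β := T₂ + W₂
    let q₀ := 1 - α * β - α * γ - β * γ + 2 * (α * β * γ)
    let u₁₀ := α * β * (1 - γ)
    let u₂₀ := α * (1 - β) * γ
    let u₃₀ := (1 - α) * β * γ
    let t₀ := α * β * γ
    let δq := -((1 - γ) * (T₁ * H₂ + H₁ * T₂ + H₁ * H₂)) - γ * (A₁ * H₂ + H₁ * B₂ + H₁ * H₂)
    let δu₁ := (1 - γ) * (T₁ * H₂ + H₁ * T₂) + H₁ * H₂
    let δu₂ := γ * (H₁ * B₂ - T₁ * H₂)
    let δu₃ := γ * (A₁ * H₂ - H₁ * T₂)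
    let δt := γ * (T₁ * H₂ + H₁ * T₂)
    t₀ ^ 2 * δq
      + (-(t₀ * (u₂₀ + u₃₀)) - u₂₀ * u₃₀) * δu₁ + (-(t₀ * (u₁₀ + u₃₀)) - u₁₀ * u₃₀) * δu₂
      + (-(t₀ * (u₁₀ + u₂₀)) - u₁₀ * u₂₀) * δu₃ + (2 * q₀ * t₀ - (u₁₀ * u₂₀ + u₁₀ * u₃₀ + u₂₀ * u₃₀)) * δt
    = α * β * γ ^ 2 *
        (H₂ * (T₁ * (1 - T₁ - A₁ - H₁ - V₁) - (A₁ * H₁ + A₁ * V₁ + H₁ * V₁))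
          + H₁ * (T₂ * (1 - T₂ - B₂ - H₂ - W₂) - (B₂ * H₂ + B₂ * W₂ + H₂ * W₂))
          + H₁ * H₂ * (α + β + A₁ + B₂ - 1)) := by
  intro α β q₀ u₁₀ u₂₀ u₃₀ t₀ δq δu₁ δu₂ δu₃ δt
  simp only [α, β, q₀, u₁₀, u₂₀, u₃₀, t₀, δq, δu₁, δu₂, δu₃, δt]
  ring

/-- `Hb` vanishes on the blob (triangle) law with side probabilities `α = T₁+V₁`, `β = T₂+W₂`, `z` (same statement as
`CubicThreePointSharp.Hb_triangle`, in this file's parametrisation). [folklore] -/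
theorem Hb_blob_eq_zero (α β z : R) :
    Hb ((1 - α) * (1 - β) * (1 - z)) (α * (1 - β) * (1 - z)) ((1 - α) * (1 - β) * z) ((1 - α) * β * (1 - z))
      (α * β + (α * (1 - β) + (1 - α) * β) * z) = 0 := by
  simp only [Hb]; ring

/-- `Ha` vanishes on the hub (star) law with arm probabilities `α, β, γ` (cf. `CubicThreePointSharp.Ha_star`). [folklore] -/
theorem Ha_hub_eq_zero (α β γ : R) :
    Ha (1 - α * β - α * γ - β * γ + 2 * (α * β * γ)) (α * β * (1 - γ)) (α * (1 - β) * γ) ((1 - α) * β * γ)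
      (α * β * γ) = 0 := by
  simp only [Ha]; ring

end Identities

/-! ### The derivatives along the perturbation, and their signs -/

/-- Calculus helper: the derivative at `0` of `y ↦ Hb` evaluated along an affine line of laws `L₀ + y·δ` is the gradient pairing
`∇Hb(L₀)·δ`. [folklore] -/
theorem hasDerivAt_Hb_line (q₀ u₁₀ u₂₀ u₃₀ t₀ δq δu₁ δu₂ δu₃ δt : ℝ) :
    HasDerivAt (fun y : ℝ => Hb (q₀ + y * δq) (u₁₀ + y * δu₁) (u₂₀ + y * δu₂) (u₃₀ + y * δu₃) (t₀ + y * δt))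
      ((2 * q₀ * t₀ - (u₁₀ * u₂₀ + u₁₀ * u₃₀ + u₂₀ * u₃₀)) * δq
        + (-(q₀ * (u₂₀ + u₃₀)) - u₂₀ * u₃₀) * δu₁ + (-(q₀ * (u₁₀ + u₃₀)) - u₁₀ * u₃₀) * δu₂
        + (-(q₀ * (u₁₀ + u₂₀)) - u₁₀ * u₂₀) * δu₃ + q₀ ^ 2 * δt) 0 := by
  have hl : ∀ c d : ℝ, HasDerivAt (fun y : ℝ => c + y * d) d 0 := by
    intro c d
    simpa using ((hasDerivAt_id (0 : ℝ)).mul_const d).const_add c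
  have hq := hl q₀ δq
  have h₁ := hl u₁₀ δu₁
  have h₂ := hl u₂₀ δu₂
  have h₃ := hl u₃₀ δu₃
  have ht := hl t₀ δt
  have key := (hq.mul ((hq.mul ht).sub (((h₁.mul h₂).add (h₁.mul h₃)).add (h₂.mul h₃)))).sub ((h₁.mul h₂).mul h₃)
  refine (key.congr_of_eventuallyEq ?_).congr_deriv ?_
  · exact Filter.Eventually.of_forall fun y => by simp only [Hb, Pi.add_apply, Pi.mul_apply, Pi.sub_apply]
  · simp only [Pi.mul_apply, Pi.add_apply, Pi.sub_apply, zero_mul, add_zero]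
    ring

/-- Calculus helper: the derivative at `0` of `y ↦ Ha` along an affine line of laws is `∇Ha(L₀)·δ`. [folklore] -/
theorem hasDerivAt_Ha_line (q₀ u₁₀ u₂₀ u₃₀ t₀ δq δu₁ δu₂ δu₃ δt : ℝ) :
    HasDerivAt (fun y : ℝ => Ha (q₀ + y * δq) (u₁₀ + y * δu₁) (u₂₀ + y * δu₂) (u₃₀ + y * δu₃) (t₀ + y * δt))
      (t₀ ^ 2 * δq
        + (-(t₀ * (u₂₀ + u₃₀)) - u₂₀ * u₃₀) * δu₁ + (-(t₀ * (u₁₀ + u₃₀)) - u₁₀ * u₃₀) * δu₂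
        + (-(t₀ * (u₁₀ + u₂₀)) - u₁₀ * u₂₀) * δu₃ + (2 * q₀ * t₀ - (u₁₀ * u₂₀ + u₁₀ * u₃₀ + u₂₀ * u₃₀)) * δt) 0 := by
  have hl : ∀ c d : ℝ, HasDerivAt (fun y : ℝ => c + y * d) d 0 := by
    intro c d
    simpa using ((hasDerivAt_id (0 : ℝ)).mul_const d).const_add c
  have hq := hl q₀ δq
  have h₁ := hl u₁₀ δu₁
  have h₂ := hl u₂₀ δu₂
  have h₃ := hl u₃₀ δu₃
  have ht := hl t₀ δt
  have key := (ht.mul ((hq.mul ht).sub (((h₁.mul h₂).add (h₁.mul h₃)).add (h₂.mul h₃)))).sub ((h₁.mul h₂).mul h₃)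
  refine (key.congr_of_eventuallyEq ?_).congr_deriv ?_
  · exact Filter.Eventually.of_forall fun y => by simp only [Ha, Pi.add_apply, Pi.mul_apply, Pi.sub_apply]
  · simp only [Pi.mul_apply, Pi.add_apply, Pi.sub_apply, zero_mul, add_zero]
    ring

/-- **THEOREM B (blob locus), derivative form.**  Along the perturbation `L₀ + y·δ` of the blob law by a new edge `vw` between the
sides `N_ab ∋ v` and `N_bc ∋ w` (cells as in the module docstring, `Q₁ = 1−T₁−A₁−B₁−V₁`, `Q₂ = 1−T₂−B₂−C₂−W₂`),
`d/dy|₀ Hb = (1−α)(1−β)(1−z)²·[B₂(AG₁ + A₁B₁) + B₁(AG₂ + B₂C₂)]`. [this work] -/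
theorem hasDerivAt_Hb_blob (T₁ A₁ B₁ V₁ T₂ B₂ C₂ W₂ z : ℝ) :
    HasDerivAt (fun y : ℝ =>
        Hb ((1 - (T₁ + V₁)) * (1 - (T₂ + W₂)) * (1 - z) + y * (-((1 - z) * (A₁ * B₂ + B₁ * B₂ + B₁ * C₂))))
          ((T₁ + V₁) * (1 - (T₂ + W₂)) * (1 - z) + y * ((1 - z) * (B₁ * C₂ - T₁ * B₂)))
          ((1 - (T₁ + V₁)) * (1 - (T₂ + W₂)) * z + y * ((1 - z) * (B₁ * B₂) - z * (A₁ * B₂ + B₁ * C₂)))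
          ((1 - (T₁ + V₁)) * (T₂ + W₂) * (1 - z) + y * ((1 - z) * (A₁ * B₂ - B₁ * T₂)))
          ((T₁ + V₁) * (T₂ + W₂) + ((T₁ + V₁) * (1 - (T₂ + W₂)) + (1 - (T₁ + V₁)) * (T₂ + W₂)) * z
            + y * ((1 - z) * (T₁ * B₂ + B₁ * T₂) + z * (A₁ * B₂ + B₁ * C₂))))
      ((1 - (T₁ + V₁)) * (1 - (T₂ + W₂)) * (1 - z) ^ 2 *
        (B₂ * (AG (1 - T₁ - A₁ - B₁ - V₁) A₁ B₁ V₁ T₁ + A₁ * B₁)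
          + B₁ * (AG (1 - T₂ - B₂ - C₂ - W₂) B₂ C₂ W₂ T₂ + B₂ * C₂))) 0 := by
  refine (hasDerivAt_Hb_line _ _ _ _ _ _ _ _ _ _).congr_deriv ?_
  have h := blob_gradient_identity T₁ A₁ B₁ V₁ T₂ B₂ C₂ W₂ z
  simp only at h
  rw [h]
  simp only [AG]
  ring

/-- **THEOREM B (blob locus), sign.**  For nonnegative cells with `σ = 1` in both channels, Gladkov's `AG ≥ 0` in the two channels
makes the first-order coefficient nonnegative: `0 ≤ (1−α)(1−β)(1−z)²·[B₂(AG₁ + A₁B₁) + B₁(AG₂ + B₂C₂)]`.  (`AG ≥ 0` holds for the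
three-point law of every bond-percolation network: `prodBernoulli_threePoint_strongHarris`.) [this work] -/
theorem blob_firstOrder_nonneg {T₁ A₁ B₁ V₁ Q₁ T₂ B₂ C₂ W₂ Q₂ z : ℝ}
    (hA₁ : 0 ≤ A₁) (hB₁ : 0 ≤ B₁) (hQ₁ : 0 ≤ Q₁) (hσ₁ : Q₁ + A₁ + B₁ + V₁ + T₁ = 1)
    (hB₂ : 0 ≤ B₂) (hC₂ : 0 ≤ C₂) (hQ₂ : 0 ≤ Q₂) (hσ₂ : Q₂ + B₂ + C₂ + W₂ + T₂ = 1)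
    (hAG₁ : 0 ≤ AG Q₁ A₁ B₁ V₁ T₁) (hAG₂ : 0 ≤ AG Q₂ B₂ C₂ W₂ T₂) :
    0 ≤ (1 - (T₁ + V₁)) * (1 - (T₂ + W₂)) * (1 - z) ^ 2 *
        (B₂ * (AG (1 - T₁ - A₁ - B₁ - V₁) A₁ B₁ V₁ T₁ + A₁ * B₁)
          + B₁ * (AG (1 - T₂ - B₂ - C₂ - W₂) B₂ C₂ W₂ T₂ + B₂ * C₂)) := by
  have hQ₁' : 1 - T₁ - A₁ - B₁ - V₁ = Q₁ := by linarith
  have hQ₂' : 1 - T₂ - B₂ - C₂ - W₂ = Q₂ := by linarith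
  rw [hQ₁', hQ₂']
  have hα : 0 ≤ 1 - (T₁ + V₁) := by linarith
  have hβ : 0 ≤ 1 - (T₂ + W₂) := by linarith
  have h1 : 0 ≤ AG Q₁ A₁ B₁ V₁ T₁ + A₁ * B₁ := by positivity
  have h2 : 0 ≤ AG Q₂ B₂ C₂ W₂ T₂ + B₂ * C₂ := by positivity
  have h3 : 0 ≤ B₂ * (AG Q₁ A₁ B₁ V₁ T₁ + A₁ * B₁) + B₁ * (AG Q₂ B₂ C₂ W₂ T₂ + B₂ * C₂) := by positivity
  positivity

/-- In the DENSE regime of a star law (`t₀ ≥ q₀`, arms `α, β, γ ∈ [0,1]`) two arms are jointly heavy: `α + β ≥ 1`. [folklore] -/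
theorem dense_star_arm_sum {α β γ : ℝ} (hα₀ : 0 ≤ α) (hα₁ : α ≤ 1) (hβ₀ : 0 ≤ β) (hγ₁ : γ ≤ 1)
    (hdense : 1 - α * β - α * γ - β * γ + 2 * (α * β * γ) ≤ α * β * γ) : 1 ≤ α + β := by
  nlinarith [mul_nonneg hα₀ hβ₀, mul_nonneg (mul_nonneg hα₀ hβ₀) (sub_nonneg.2 hγ₁), mul_nonneg hα₀ (sub_nonneg.2 hγ₁),
    mul_nonneg hβ₀ (sub_nonneg.2 hγ₁), mul_nonneg hβ₀ (sub_nonneg.2 hα₁)]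

/-- **THEOREM H (hub locus), derivative form.**  Along the perturbation `L₀ + y·δ` of the star law by a chord `vw` between the arms
`N_a ∋ v` and `N_b ∋ w` (cells as in the module docstring, `Q₁ = 1−T₁−A₁−H₁−V₁`, `Q₂ = 1−T₂−B₂−H₂−W₂`),
`d/dy|₀ Ha = αβγ²·[H₂·AG₁ + H₁·AG₂ + H₁H₂(α+β+A₁+B₂−1)]`. [this work] -/
theorem hasDerivAt_Ha_hub (T₁ A₁ H₁ V₁ T₂ B₂ H₂ W₂ γ : ℝ) :
    HasDerivAt (fun y : ℝ =>
        Ha (1 - (T₁ + V₁) * (T₂ + W₂) - (T₁ + V₁) * γ - (T₂ + W₂) * γ + 2 * ((T₁ + V₁) * (T₂ + W₂) * γ)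
            + y * (-((1 - γ) * (T₁ * H₂ + H₁ * T₂ + H₁ * H₂)) - γ * (A₁ * H₂ + H₁ * B₂ + H₁ * H₂)))
          ((T₁ + V₁) * (T₂ + W₂) * (1 - γ) + y * ((1 - γ) * (T₁ * H₂ + H₁ * T₂) + H₁ * H₂))
          ((T₁ + V₁) * (1 - (T₂ + W₂)) * γ + y * (γ * (H₁ * B₂ - T₁ * H₂)))
          ((1 - (T₁ + V₁)) * (T₂ + W₂) * γ + y * (γ * (A₁ * H₂ - H₁ * T₂)))
          ((T₁ + V₁) * (T₂ + W₂) * γ + y * (γ * (T₁ * H₂ + H₁ * T₂))))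
      ((T₁ + V₁) * (T₂ + W₂) * γ ^ 2 *
        (H₂ * AG (1 - T₁ - A₁ - H₁ - V₁) A₁ H₁ V₁ T₁ + H₁ * AG (1 - T₂ - B₂ - H₂ - W₂) B₂ H₂ W₂ T₂
          + H₁ * H₂ * ((T₁ + V₁) + (T₂ + W₂) + A₁ + B₂ - 1))) 0 := by
  refine (hasDerivAt_Ha_line _ _ _ _ _ _ _ _ _ _).congr_deriv ?_
  have h := hub_gradient_identity T₁ A₁ H₁ V₁ T₂ B₂ H₂ W₂ γ
  simp only at h
  rw [h]
  simp only [AG]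
  ring

/-- **THEOREM H (hub locus), sign.**  For nonnegative cells with `σ = 1` in both arms, `γ` arbitrary, Gladkov's `AG ≥ 0` in the two
arms and `α + β + A₁ + B₂ ≥ 1` (in particular `α + β ≥ 1`, which holds throughout the dense regime by `dense_star_arm_sum`) make
the first-order coefficient of `Ha` nonnegative. [this work] -/
theorem hub_firstOrder_nonneg {T₁ A₁ H₁ V₁ Q₁ T₂ B₂ H₂ W₂ Q₂ γ : ℝ}
    (hT₁ : 0 ≤ T₁) (hH₁ : 0 ≤ H₁) (hV₁ : 0 ≤ V₁) (hσ₁ : Q₁ + A₁ + H₁ + V₁ + T₁ = 1)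
    (hT₂ : 0 ≤ T₂) (hH₂ : 0 ≤ H₂) (hW₂ : 0 ≤ W₂) (hσ₂ : Q₂ + B₂ + H₂ + W₂ + T₂ = 1)
    (hAG₁ : 0 ≤ AG Q₁ A₁ H₁ V₁ T₁) (hAG₂ : 0 ≤ AG Q₂ B₂ H₂ W₂ T₂)
    (hheavy : 1 ≤ (T₁ + V₁) + (T₂ + W₂) + A₁ + B₂) :
    0 ≤ (T₁ + V₁) * (T₂ + W₂) * γ ^ 2 *
        (H₂ * AG (1 - T₁ - A₁ - H₁ - V₁) A₁ H₁ V₁ T₁ + H₁ * AG (1 - T₂ - B₂ - H₂ - W₂) B₂ H₂ W₂ T₂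
          + H₁ * H₂ * ((T₁ + V₁) + (T₂ + W₂) + A₁ + B₂ - 1)) := by
  have hQ₁' : 1 - T₁ - A₁ - H₁ - V₁ = Q₁ := by linarith
  have hQ₂' : 1 - T₂ - B₂ - H₂ - W₂ = Q₂ := by linarith
  rw [hQ₁', hQ₂']
  have hα : 0 ≤ T₁ + V₁ := by linarith
  have hβ : 0 ≤ T₂ + W₂ := by linarith
  have hh : 0 ≤ (T₁ + V₁) + (T₂ + W₂) + A₁ + B₂ - 1 := by linarith
  have h3 : 0 ≤ H₂ * AG Q₁ A₁ H₁ V₁ T₁ + H₁ * AG Q₂ B₂ H₂ W₂ T₂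
      + H₁ * H₂ * ((T₁ + V₁) + (T₂ + W₂) + A₁ + B₂ - 1) := by positivity
  positivity

/-! ### Higher-order structure along the one-edge segment

The law of `B + y·vw` is EXACTLY affine in the weight `y` of the new edge, `L(y) = L₀ + y·δ`, and `Ha`, `Hb` are cubic forms, so
`Hb(L(y)) = D·y + E·y² + F·y³` with `D = ∇Hb(L₀)·δ` (signed above), `F = Hb(δ)` and `E` the polarised second-order term
(`two_mul_Hb_line` below, a general identity for the cubic form).  For the blob perturbation the top coefficient is an explicit
PRODUCT of nonnegative cells (`Hb_blob_delta`), for the hub chord it is minus such a product (`Ha_hub_delta`).  (Numerically — memo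
KCLUSTER-gen28 §6 — the whole segment `y ∈ [0,1]` satisfies `max(Ha,Hb) ≥ 0` for all AG-feasible channel laws: recorded there as the
'one-edge classes' conjecture; only the first- and third-order coefficients are settled here.) -/

section Cubic

variable {R : Type*} [CommRing R]

/-- Taylor expansion of the cubic form `Hb` along a line, with the coefficients written by polarisation (any commutative ring; stated
with a factor `2` to avoid division): `2·Hb(x + y d) = 2·Hb(x) + y·(Hb(x+d) − Hb(x−d) − 2Hb(d)) + y²·(Hb(x+d) + Hb(x−d) − 2Hb(x)) + 2y³·Hb(d)`. [folklore] -/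
theorem two_mul_Hb_line (q u₁ u₂ u₃ t dq d₁ d₂ d₃ dt y : R) :
    2 * Hb (q + y * dq) (u₁ + y * d₁) (u₂ + y * d₂) (u₃ + y * d₃) (t + y * dt)
    = 2 * Hb q u₁ u₂ u₃ t
      + y * (Hb (q + dq) (u₁ + d₁) (u₂ + d₂) (u₃ + d₃) (t + dt) - Hb (q - dq) (u₁ - d₁) (u₂ - d₂) (u₃ - d₃) (t - dt)
              - 2 * Hb dq d₁ d₂ d₃ dt)
      + y ^ 2 * (Hb (q + dq) (u₁ + d₁) (u₂ + d₂) (u₃ + d₃) (t + dt) + Hb (q - dq) (u₁ - d₁) (u₂ - d₂) (u₃ - d₃) (t - dt)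
              - 2 * Hb q u₁ u₂ u₃ t)
      + 2 * y ^ 3 * Hb dq d₁ d₂ d₃ dt := by
  simp only [Hb]; ring

/-- The same Taylor/polarisation identity for the cubic form `Ha`. [folklore] -/
theorem two_mul_Ha_line (q u₁ u₂ u₃ t dq d₁ d₂ d₃ dt y : R) :
    2 * Ha (q + y * dq) (u₁ + y * d₁) (u₂ + y * d₂) (u₃ + y * d₃) (t + y * dt)
    = 2 * Ha q u₁ u₂ u₃ t
      + y * (Ha (q + dq) (u₁ + d₁) (u₂ + d₂) (u₃ + d₃) (t + dt) - Ha (q - dq) (u₁ - d₁) (u₂ - d₂) (u₃ - d₃) (t - dt)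
              - 2 * Ha dq d₁ d₂ d₃ dt)
      + y ^ 2 * (Ha (q + dq) (u₁ + d₁) (u₂ + d₂) (u₃ + d₃) (t + dt) + Ha (q - dq) (u₁ - d₁) (u₂ - d₂) (u₃ - d₃) (t - dt)
              - 2 * Ha q u₁ u₂ u₃ t)
      + 2 * y ^ 3 * Ha dq d₁ d₂ d₃ dt := by
  simp only [Ha]; ring

/-- **Blob locus, third-order coefficient**: the cubic form `Hb` evaluated at the blob perturbation direction `δ` (module docstring) is
the explicit product `(1−z)²·B₁B₂·(A₁B₂ + B₁C₂)·(T₁+A₁+B₁)·(T₂+B₂+C₂)` — nonnegative for nonnegative cells, and zero exactly when the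
new edge cannot create an `a~v=w~c` route avoiding `b` from both sides. [this work] -/
theorem Hb_blob_delta (T₁ A₁ B₁ T₂ B₂ C₂ z : R) :
    Hb (-((1 - z) * (A₁ * B₂ + B₁ * B₂ + B₁ * C₂))) ((1 - z) * (B₁ * C₂ - T₁ * B₂))
      ((1 - z) * (B₁ * B₂) - z * (A₁ * B₂ + B₁ * C₂)) ((1 - z) * (A₁ * B₂ - B₁ * T₂))
      ((1 - z) * (T₁ * B₂ + B₁ * T₂) + z * (A₁ * B₂ + B₁ * C₂))
    = (1 - z) ^ 2 * (B₁ * B₂) * (A₁ * B₂ + B₁ * C₂) * (T₁ + A₁ + B₁) * (T₂ + B₂ + C₂) := by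
  simp only [Hb]; ring

/-- **Hub locus, third-order coefficient**: the cubic form `Ha` at the chord direction `δ` of a hub network is MINUS an explicit product,
`−γ²·H₁H₂·(T₁+A₁)(T₂+B₂)·(H₁H₂ + H₁T₂ + T₁H₂)`. [this work] -/
theorem Ha_hub_delta (T₁ A₁ H₁ T₂ B₂ H₂ γ : R) :
    Ha (-((1 - γ) * (T₁ * H₂ + H₁ * T₂ + H₁ * H₂)) - γ * (A₁ * H₂ + H₁ * B₂ + H₁ * H₂))
      ((1 - γ) * (T₁ * H₂ + H₁ * T₂) + H₁ * H₂) (γ * (H₁ * B₂ - T₁ * H₂)) (γ * (A₁ * H₂ - H₁ * T₂))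
      (γ * (T₁ * H₂ + H₁ * T₂))
    = -(γ ^ 2 * (H₁ * H₂) * (T₁ + A₁) * (T₂ + B₂) * (H₁ * H₂ + H₁ * T₂ + T₁ * H₂)) := by
  simp only [Ha]; ring

/-- For nonnegative cells (any `z`) the blob top coefficient is nonnegative. [this work] -/
theorem Hb_blob_delta_nonneg {T₁ A₁ B₁ T₂ B₂ C₂ z : ℝ} (hT₁ : 0 ≤ T₁) (hA₁ : 0 ≤ A₁) (hB₁ : 0 ≤ B₁) (hT₂ : 0 ≤ T₂)
    (hB₂ : 0 ≤ B₂) (hC₂ : 0 ≤ C₂) :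
    0 ≤ Hb (-((1 - z) * (A₁ * B₂ + B₁ * B₂ + B₁ * C₂))) ((1 - z) * (B₁ * C₂ - T₁ * B₂))
      ((1 - z) * (B₁ * B₂) - z * (A₁ * B₂ + B₁ * C₂)) ((1 - z) * (A₁ * B₂ - B₁ * T₂))
      ((1 - z) * (T₁ * B₂ + B₁ * T₂) + z * (A₁ * B₂ + B₁ * C₂)) := by
  rw [Hb_blob_delta]; positivity

end Cubic

end CubicThreePointLocus

end Summit.CriticalPhenomena.PercolationContinuityZ3.Theorems
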